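import Literature.MathematicalPhysics.QuantumFieldTheory.Balaban1983to89.T4PersistenceDictionary

/-!
# `Balaban1983to89.T4PersistenceGrove` — THE BANKED RENEWAL CONSTRUCTOR ON THE LINEARISED (ID) LEDGER: groves of
genealogies, the one-event ledger step, the effective horizon SUPPLIED BY THE LEDGER, and NE7b's unprinted clause
reduced to two RAW relative prices (cell `pub-balaban`, node U5c / spine estimate NE7b, RENEWAL member; journal CLAIM
T4-U5c.E-NE7b-PROVE-P2d* — a self-row under T4-DAG v19 §8 Q24(a) —, unit b2b-balaban-t4-ne7b-p2 gen 4, the lineage of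
`T4PersistenceRenewal`; companion record `t4/T4-EST-NE7b-P2.md` v2.5; imports `…T4PersistenceDictionary` ONLY (hence
both NE7b leaves) and modifies nothing)

HONEST FRAMING (cell `pub-balaban`, T4-DAG PAGE 1).  The cell's T4 target is the existence AND uniqueness of the
`ε → 0` limit of Bałaban's unit-scale block-averaged expectations on a FIXED finite four-torus ([Balaban1988Convergent]
Cor. 3 p. 264, [Balaban1989LargeFieldII] Thm 1 p. 355 are ultraviolet STABILITY only) — NOT infinite volume, NOT a mass
gap, NOT the Clay problem.  This module is [folklore] finite combinatorics and real arithmetic (zero `sorry`, zero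
cite-tagged hypothesis, no `def … : Prop` fact of Bałaban's); it uses NONE of the cell's conditionals (BetaPertH, (B),
(B^μ)), which stay binders of the consumer.  B16 = [Balaban1989LargeFieldII] is a manuscript UNDER AUDIT; the page
pointers below repeat the LOCATIONS fixed by the (ID) dictionary `…T4PersistenceDictionary` (its header, (L1)–(L3)) and
by `…T4PersistenceRenewal` §14 — they identify what the ledger MODELS and are never used as establishing a disputed step.
Value = kernel bookkeeping around a located gap; NOT an estimate, NOT summit progress.

WHERE THIS SITS.  `…T4PersistenceRenewal.ForestDom.of_banked_pricing_le` (v2.4 §14) inhabits the renewal carrier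
`ForestDom` / `EventDom` from a forest of slot histories once the consumer supplies (a) the EFFECTIVE REMAINING HORIZON
`E c` of every component, (b) ‹alive across the horizon› `Ah − last c ≤ E c` on the pending class, and (c) the BANKED
price `ω c·z₁^(E c)·z₁^lag ≤ φ·(ω (parent c)·z₁^(E (parent c)))` per edge — whose dictionary content («each edge pays only
its own horizon increment», `horizonIncrement_le`) was left to the instantiating seat.  The (ID) dictionary
(`…T4PersistenceDictionary.Gen`, `Gen.reach` = the three located lifetime rules (L1) birth `j + W b`, (L2) renewal
`h + 1 + W e`, (L3) merger `max reach + W e` with the merger window DEFERRED to the later partner horizon, B16 pp. 385–387)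
instantiated the renewal carrier only on the OWN-WINDOW side (`pairKernel_live`, `pairKernel_live_renew`: pure renewal
chains).  This module supplies (a), (b), (c) FROM THE LEDGER for general genealogies — births of later constituents,
renewals, mergers, in any order and number:
* §1 GROVES `Grove ε = Multiset (Gen ε)` — the genealogy trees of ONE slot present in a history (a truncated history may
  hold several not-yet-merged trees) — with `mreach W g` = the largest reach; the ONE-EVENT LEDGER STEP `Step W g e s g'`
  = the three rules as transitions (a constituent born at step `s` while the slot is alive, `s ≤ mreach g`; a renewal of
  one tree at readiness `h < reach`; a binary merger of two trees at a step `s` at which both are alive, window deferred),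
  and the two lemmas every later statement rests on: `Step.le_mreach` (an event happens no later than the current
  reach) and `Step.mreach_le` (ONE event raises the reach by at most ITS OWN window `W e` — for a merger the deferred
  `n₁ + R`, never the partner's inherited remainder); SCRIPTS `Script W g l g'` (finite chains of steps) with
  `Script.mreach_le` (the reach grows by at most the SUM of the own windows — a merger chain does not accumulate
  inherited horizons: the obstruction (v16 b) of the record's census does not arise in banked currency) and
  `Script.head_le_mreach`; `Step.renew_of_wf` / `Step.merge_of_wf` — a renewal / merger that is well-formed in the
  dictionary's sense (`Gen.WF`: renewal while pending; partners alive together) IS a ledger step (the merger at the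
  earliest admissible step, the later root step).  Nothing here requires distinct event names or well-formed trees: the
  reach arithmetic holds without them.
* §2 THE EDGE ARITHMETIC: `Step.increment` / `Script.increment` — if `grove c` arises from `grove (parent c)` by a script
  whose FIRST event is the undone edge event at absolute step `j + last c` (the later events of the script being its
  DETERMINED consequences, e.g. the merger that a region born next to the component triggers — reading (m1)/(m2) of the
  record §3 — or none), then with `E x = mreach (grove x) − (j + last x)`:
  `E c + lag ≤ E (parent c) + booking c` and `lag ≤ E (parent c)`, `booking c` = the sum of the script's own windows;
  `banked_price_of_increment` turns a RAW price `ω c ≤ pr c·ω (parent c)` and the OWN-BOOKING pairing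
  `pr c·z₁^(booking c) ≤ φ` into the banked price (c).
* §3 THE CONSTRUCTORS `forestDom_of_grove_le` (root side as a profile `b`, exactly as `of_banked_pricing_le`) and
  `forestDom_of_grove_raw` (root side raw too): `ForestDom Pend w a₀ Ah z η B₀ (1/(1 − z₁⁻¹z))` from — LEDGER: `hroot`
  (a root is the bare birth of the slot's first region at step `j`, age `0`, followed by its determined script), `hstep`
  (every other component arises from its parent by a script headed by the undone event at step `j + last c`), `hpend`
  (a PENDING history's grove reaches beyond the horizon, `j + Ah < mreach`); CATALOGUE: (SH) injective shapes, the
  pairings `pr c·z₁^(booking c) ≤ φ (age, lag, shape)`, (ENT) `Σ_{σ ∈ Shapes s ℓ} φ ≤ ε` at ages `≤ Ah`, the root pairing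
  mass `Σ_roots pr c·z₁^(booking c) ≤ B₀`, the slack `ε·(z/z₁)/(1 − z/z₁) ≤ 1 − η`; and THE TWO UNPRINTED CLAUSES, now in
  RAW currency with no horizon, window or tilt left in them: (E2-rel-raw) `ω c ≤ pr c·a₀` on roots — inserting one bare
  large-field region at the slot into the frozen context `τ″` costs at most `pr` times the context weight — and (PR-raw)
  `ω c ≤ pr c·ω (parent c)` on the other components — one more switchable event (renewal field, joining region) costs at
  most `pr` times the truncated history's weight —, both CONTEXT-UNIFORM inside the positive weights of (1.104).  This is
  cell gap G-ne7bp2-1 (the wall of the renewal member) in its final currency; printed TOWARDS it are the new factors of the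
  operation applied ((1.79) p. 383, «the new factor exp(−p₀(g_j))» p. 386, the surplus (1.87) p. 387) along ONE sequence of
  operations; NOT printed is the comparison of the REST of the two weights (later steps act on different domain
  geometry), uniformly in the context — record `t4/T4-EST-NE7b-P2.md` §3.
* §4 NON-VACUITY, decided on the dictionary's own sanity genealogy `G₀ = merge (born 0 0) (born 1 1) 2`, windows
  `W₀ = 3, 4, 2`: the script ROOT `{born 0 0}` (reach 3) → BIRTH of constituent `1` at step `1` (grove reach 5) → MERGER
  at step `3` (reach 7) is two ledger steps; the horizons are `3, 4, 4`; the birth edge books `4 + 1 ≤ 3 + 4`, the merger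
  edge is TIGHT `4 + 2 = 4 + 2`; read as ONE m1 edge with a determined merger (script of length 2; horizon `7 − 1 = 6`)
  it books `6 + 1 ≤ 3 + (4 + 2)`; `Gen.WF`-well-formedness of `G₀` (`G₀_wf`) yields the merger step as well.
WHERE THE MODEL IS STRONGER / WEAKER THAN THE PAGE (flagged; all harmless for UPPER bounds): an event may happen at any
step `≤` the current reach (print: renewals at readiness, mergers during the operations of one step); the merger STEP is
data of the history, constrained only by ‹both partners alive› (the dictionary's `Gen` does not record it — its `place`
is the deferred WINDOW start, not the event step); which later events are DETERMINED consequences of an edge (the script's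
tail) is the consumer's reading — the arithmetic holds for any tail; intermediate forest nodes may be groves of several
trees (the parent of a component bridged by a later-born region), i.e. histories of the run outside the insertion fibre,
as `EventForest.Cmp ⊇ Pend` allows.  NOT KERNEL, NOT PRINTED: (E2-rel-raw), (PR-raw) above — the consumer's binders
`hraw₀`, `hraw`.
-/

open Finset

namespace Literature.MathematicalPhysics.QuantumFieldTheory.Balaban1983to89.T4PersistenceGrove

open Literature.MathematicalPhysics.QuantumFieldTheory.Balaban1983to89
open T4PersistenceDictionary T4PersistenceRenewal

/-! ## §1 Groves, the one-event ledger step, scripts -/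

section Grove

variable {ε : Type*}

/-- **GROVE**: the genealogy trees of one slot present in a (possibly truncated) history — a multiset of the
dictionary's genealogies `Gen ε`. [folklore] -/
abbrev Grove (ε : Type*) := Multiset (Gen ε)

/-- The REACH of a grove: the largest reach of its trees (`0` for the empty grove). [folklore] -/
def mreach (W : ε → ℕ) (g : Grove ε) : ℕ := (g.map (Gen.reach W)).sup

/-- the empty grove reaches nothing [folklore] -/
@[simp] theorem mreach_zero (W : ε → ℕ) : mreach W (0 : Grove ε) = 0 := by
  simp [mreach]

/-- adding a tree: the reach is the larger of the tree's reach and the old reach [folklore] -/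
@[simp] theorem mreach_cons (W : ε → ℕ) (X : Gen ε) (g : Grove ε) :
    mreach W (X ::ₘ g) = max (X.reach W) (mreach W g) := by
  simp only [mreach, Multiset.map_cons, Multiset.sup_cons]

/-- a singleton grove reaches as far as its tree [folklore] -/
@[simp] theorem mreach_singleton (W : ε → ℕ) (X : Gen ε) : mreach W ({X} : Grove ε) = X.reach W := by
  rw [← Multiset.cons_zero, mreach_cons, mreach_zero, Nat.max_zero]

/-- every tree of a grove reaches at most the grove's reach [folklore] -/
theorem reach_le_mreach (W : ε → ℕ) {X : Gen ε} {g : Grove ε} (h : X ∈ g) : X.reach W ≤ mreach W g :=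
  Multiset.le_sup (Multiset.mem_map_of_mem _ h)

/-- **THE ONE-EVENT LEDGER STEP** `Step W g e s g'`: the grove `g'` arises from `g` by ONE event `e` at absolute step
`s`, by one of the dictionary's three located rules (`Gen.reach`, B16 pp. 385–387 as LOCATIONS): `birth` — a new
large-field region `b` is born at step `s` while the slot is alive (`s ≤ mreach g`; its tree `born b s`, reach `s + W b`,
(L1)); `renew` — one tree `X`, ready at step `h < reach X`, acquires a new field: event at step `h + 1`, tree
`renew X e h`, reach `h + 1 + W e` ((L2), «K = R_{j+1} for Z» p. 386); `merge` — two trees `X`, `Y`, both alive at step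
`s` (`s ≤ reach X`, `s ≤ reach Y`), are joined: tree `merge X Y e`, reach `max (reach X) (reach Y) + W e` — the merger
window DEFERRED to the later partner horizon ((L3), «K ≤ K₂ + n₁ + R_{j+1}» p. 387).  Groves being multisets, the
affected trees may sit anywhere. [folklore] -/
inductive Step (W : ε → ℕ) : Grove ε → ε → ℕ → Grove ε → Prop
  | birth {g : Grove ε} {b : ε} {s : ℕ} (hs : s ≤ mreach W g) : Step W g b s (Gen.born b s ::ₘ g)
  | renew {g : Grove ε} {X : Gen ε} {e : ε} {h : ℕ} (hh : h < X.reach W) :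
      Step W (X ::ₘ g) e (h + 1) (Gen.renew X e h ::ₘ g)
  | merge {g : Grove ε} {X Y : Gen ε} {e : ε} {s : ℕ} (hX : s ≤ X.reach W) (hY : s ≤ Y.reach W) :
      Step W (X ::ₘ Y ::ₘ g) e s (Gen.merge X Y e ::ₘ g)

/-- **AN EVENT HAPPENS WHILE THE SLOT IS ALIVE**: the step of a ledger event is at most the current reach. [folklore] -/
theorem Step.le_mreach {W : ε → ℕ} {g g' : Grove ε} {e : ε} {s : ℕ} (h : Step W g e s g') : s ≤ mreach W g := by
  cases h with
  | birth hs => exact hs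
  | renew hh => rw [mreach_cons]; exact le_trans (Nat.succ_le_of_lt hh) (le_max_left _ _)
  | merge hX hY => rw [mreach_cons]; exact hX.trans (le_max_left _ _)

/-- **ONE EVENT RAISES THE REACH BY AT MOST ITS OWN WINDOW**: `mreach g' ≤ mreach g + W e` — for a birth because the
region is born no later than the current reach, for a renewal because it happens before the renewed tree's reach, for a
merger because its window is deferred to the later PARTNER horizon, which is at most the grove's. [folklore] -/
theorem Step.mreach_le {W : ε → ℕ} {g g' : Grove ε} {e : ε} {s : ℕ} (h : Step W g e s g') :
    mreach W g' ≤ mreach W g + W e := by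
  cases h with
  | birth hs =>
      rw [mreach_cons, Gen.reach_born]
      exact max_le (Nat.add_le_add_right hs _) (Nat.le_add_right _ _)
  | renew hh =>
      rw [mreach_cons, mreach_cons, Gen.reach_renew]
      refine max_le ?_ ?_
      · exact le_trans (Nat.add_le_add_right (Nat.succ_le_of_lt hh) _) (Nat.add_le_add_right (le_max_left _ _) _)
      · exact le_trans (Nat.le_add_right _ _) (Nat.add_le_add_right (le_max_right _ _) _)
  | merge hX hY =>
      rw [mreach_cons, mreach_cons, mreach_cons, Gen.reach_merge]
      refine max_le (Nat.add_le_add_right (max_le (le_max_left _ _) ?_) _) ?_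
      · exact le_trans (le_max_left _ _) (le_max_right _ _)
      · exact le_trans (le_trans (le_max_right _ _) (le_max_right _ _)) (Nat.le_add_right _ _)

/-- A well-formed genealogy starts no later than it ends: `rootStep ≤ reach` (`Gen.rootStep_le_place` at the last event).
[folklore] -/
theorem rootStep_le_reach_of_wf [DecidableEq ε] (W : ε → ℕ) {G : Gen ε} (hG : G.WF W) : G.rootStep ≤ G.reach W := by
  rw [G.reach_eq_place_top W]
  exact (G.rootStep_le_place W hG G.top G.top_mem).trans (Nat.le_add_right _ _)

/-- **THE DICTIONARY'S WELL-FORMED RENEWAL IS A LEDGER STEP**: `(renew X e h).WF W` carries `h < reach X`. [folklore] -/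
theorem Step.renew_of_wf [DecidableEq ε] {W : ε → ℕ} {X : Gen ε} {e : ε} {h : ℕ} (hW : (Gen.renew X e h).WF W)
    (g : Grove ε) : Step W (X ::ₘ g) e (h + 1) (Gen.renew X e h ::ₘ g) := by
  simp only [Gen.WF] at hW
  exact Step.renew hW.2.2.2

/-- **THE DICTIONARY'S WELL-FORMED MERGER IS A LEDGER STEP** at the earliest admissible step, the later root step
(`Gen.WF`: the partners' lives `[rootStep, reach)` overlap, so both are alive then). [folklore] -/
theorem Step.merge_of_wf [DecidableEq ε] {W : ε → ℕ} {X Y : Gen ε} {e : ε} (hW : (Gen.merge X Y e).WF W)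
    (g : Grove ε) : Step W (X ::ₘ Y ::ₘ g) e (max X.rootStep Y.rootStep) (Gen.merge X Y e ::ₘ g) := by
  simp only [Gen.WF] at hW
  obtain ⟨hX, hY, -, -, -, hXY, hYX⟩ := hW
  exact Step.merge (max_le (rootStep_le_reach_of_wf W hX) hYX.le) (max_le hXY.le (rootStep_le_reach_of_wf W hY))

/-- **SCRIPT**: a finite chain of ledger steps, listed as (event, step) pairs in order of application. [folklore] -/
inductive Script (W : ε → ℕ) : Grove ε → List (ε × ℕ) → Grove ε → Prop
  | nil (g : Grove ε) : Script W g [] g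
  | cons {g g' g'' : Grove ε} {e : ε} {s : ℕ} {l : List (ε × ℕ)} (hs : Step W g e s g') (hl : Script W g' l g'') :
      Script W g ((e, s) :: l) g''

/-- The total OWN WINDOW of a list of events. [folklore] -/
def windows (W : ε → ℕ) (l : List (ε × ℕ)) : ℕ := (l.map fun p => W p.1).sum

/-- no events, no window [folklore] -/
@[simp] theorem windows_nil (W : ε → ℕ) : windows W ([] : List (ε × ℕ)) = 0 := rfl

/-- the window of a list is the head's own window plus the tail's [folklore] -/
@[simp] theorem windows_cons (W : ε → ℕ) (e : ε) (s : ℕ) (l : List (ε × ℕ)) :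
    windows W ((e, s) :: l) = W e + windows W l := by
  simp [windows]

/-- a one-step script [folklore] -/
theorem Script.single {W : ε → ℕ} {g g' : Grove ε} {e : ε} {s : ℕ} (h : Step W g e s g') :
    Script W g [(e, s)] g' :=
  Script.cons h (Script.nil g')

/-- scripts compose [folklore] -/
theorem Script.append {W : ε → ℕ} {g g' g'' : Grove ε} {l l' : List (ε × ℕ)} (h : Script W g l g')
    (h' : Script W g' l' g'') : Script W g (l ++ l') g'' := by
  induction h with
  | nil g => exact h'
  | cons hs _ ih => exact Script.cons hs (ih h')

/-- **A SCRIPT RAISES THE REACH BY AT MOST THE SUM OF ITS OWN WINDOWS** — however many mergers it chains, no inherited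
horizon is ever booked twice (`Step.mreach_le` iterated). [folklore] -/
theorem Script.mreach_le {W : ε → ℕ} {g g' : Grove ε} {l : List (ε × ℕ)} (h : Script W g l g') :
    mreach W g' ≤ mreach W g + windows W l := by
  induction h with
  | nil g => simp
  | cons hs _ ih =>
      rw [windows_cons, ← Nat.add_assoc]
      exact ih.trans (Nat.add_le_add_right hs.mreach_le _)

/-- The FIRST event of a script happens while the slot is alive: its step is at most the initial reach. [folklore] -/
theorem Script.head_le_mreach {W : ε → ℕ} {g g' : Grove ε} {e : ε} {s : ℕ} {l : List (ε × ℕ)}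
    (h : Script W g ((e, s) :: l) g') : s ≤ mreach W g := by
  cases h with
  | cons hs _ => exact hs.le_mreach

end Grove

/-! ## §2 The edge arithmetic: effective horizon supplied by the ledger, increment paid by the own booking -/

section Edge

variable {ε : Type*}

/-- **THE INCREMENT OF ONE EDGE** (ledger arithmetic).  The parent's last event is at age `lp`, the child's at age
`lc ≥ lp` (absolute step `j + lc`); the child's grove arises from the parent's by a script HEADED by the undone event at
step `j + lc` (tail = its determined consequences).  With the effective horizons `E = mreach − (j + age of last event)`:
the lag is at most the parent's horizon, and horizon-plus-lag grows by at most the script's own windows. [folklore] -/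
theorem Script.increment {W : ε → ℕ} {g g' : Grove ε} {e : ε} {l : List (ε × ℕ)} {j lp lc : ℕ}
    (h : Script W g ((e, j + lc) :: l) g') (hl : lp ≤ lc) :
    (mreach W g' - (j + lc)) + (lc - lp) ≤ (mreach W g - (j + lp)) + windows W ((e, j + lc) :: l) ∧
      lc - lp ≤ mreach W g - (j + lp) := by
  have h1 := h.head_le_mreach
  have h2 := h.mreach_le
  constructor <;> omega

/-- The one-step case of `Script.increment`: booking = the event's own window. [folklore] -/
theorem Step.increment {W : ε → ℕ} {g g' : Grove ε} {e : ε} {j lp lc : ℕ} (h : Step W g e (j + lc) g')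
    (hl : lp ≤ lc) :
    (mreach W g' - (j + lc)) + (lc - lp) ≤ (mreach W g - (j + lp)) + W e ∧ lc - lp ≤ mreach W g - (j + lp) := by
  simpa using (Script.single h).increment hl

/-- A ROOT's horizon is at most its booking: a grove scripted from the bare birth `born b j` reaches at most
`j + W b + windows`. [folklore] -/
theorem Script.root_horizon_le {W : ε → ℕ} {g : Grove ε} {b : ε} {j : ℕ} {l : List (ε × ℕ)}
    (h : Script W ({Gen.born b j} : Grove ε) l g) : mreach W g - j ≤ W b + windows W l := by
  have h2 := h.mreach_le
  rw [mreach_singleton, Gen.reach_born] at h2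
  omega

/-- **THE BANKED PRICE FROM A RAW PRICE AND THE OWN-BOOKING PAIRING** (cf. `…T4PersistenceRenewal.banked_price_of_pairing`,
which takes the increment in `max` form): `0 ≤ ωc ≤ pr·ωp`, `pr·z₁^B ≤ φv`, `1 ≤ z₁`, `Ec + ℓ ≤ Ep + B` ⇒
`ωc·z₁^Ec·z₁^ℓ ≤ φv·(ωp·z₁^Ep)`. [folklore] -/
theorem banked_price_of_increment {ωc ωp pr φv z₁ : ℝ} {Ec Ep ℓ B : ℕ} (hz₁ : 1 ≤ z₁) (hωc : 0 ≤ ωc)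
    (hωp : 0 ≤ ωp) (hω : ωc ≤ pr * ωp) (hpair : pr * z₁ ^ B ≤ φv) (hinc : Ec + ℓ ≤ Ep + B) :
    ωc * z₁ ^ Ec * z₁ ^ ℓ ≤ φv * (ωp * z₁ ^ Ep) := by
  have hz0 : 0 ≤ z₁ := le_trans zero_le_one hz₁
  have hpow : z₁ ^ (Ec + ℓ) ≤ z₁ ^ (Ep + B) := pow_le_pow_right₀ hz₁ hinc
  calc ωc * z₁ ^ Ec * z₁ ^ ℓ = ωc * z₁ ^ (Ec + ℓ) := by rw [mul_assoc, ← pow_add]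
    _ ≤ ωc * z₁ ^ (Ep + B) := mul_le_mul_of_nonneg_left hpow hωc
    _ ≤ pr * ωp * z₁ ^ (Ep + B) := mul_le_mul_of_nonneg_right hω (pow_nonneg hz0 _)
    _ = pr * z₁ ^ B * (ωp * z₁ ^ Ep) := by rw [pow_add]; ring
    _ ≤ φv * (ωp * z₁ ^ Ep) := mul_le_mul_of_nonneg_right hpair (mul_nonneg hωp (pow_nonneg hz0 _))

/-- A ROOT's banked potential under its raw price: `0 ≤ ω ≤ pr·a₀`, `1 ≤ z₁`, `E ≤ B` ⇒ `ω·z₁^E ≤ pr·z₁^B·a₀`. [folklore] -/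
theorem banked_root_of_raw {ω pr a₀ z₁ : ℝ} {E B : ℕ} (hz₁ : 1 ≤ z₁) (hω0 : 0 ≤ ω) (hω : ω ≤ pr * a₀)
    (hE : E ≤ B) : ω * z₁ ^ E ≤ pr * z₁ ^ B * a₀ := by
  have hz0 : 0 ≤ z₁ := le_trans zero_le_one hz₁
  calc ω * z₁ ^ E ≤ ω * z₁ ^ B := mul_le_mul_of_nonneg_left (pow_le_pow_right₀ hz₁ hE) hω0
    _ ≤ pr * a₀ * z₁ ^ B := mul_le_mul_of_nonneg_right hω (pow_nonneg hz0 _)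
    _ = pr * z₁ ^ B * a₀ := by ring

end Edge

/-! ## §3 The constructors: `ForestDom` from the ledger realisation, the catalogue, and the two raw price clauses -/

section Constructor

variable {ι : Type*} [DecidableEq ι] {ε : Type*}

/-- **THE EFFECTIVE REMAINING HORIZON SUPPLIED BY THE LEDGER**: the grove's reach minus the absolute step `j + last c`
of the component's last (switchable) event. [folklore] -/
def horizon (W : ε → ℕ) (j : ℕ) (Φ : EventForest ι) (grove : ι → Grove ε) (c : ι) : ℕ :=
  mreach W (grove c) - (j + Φ.last c)

/-- The BOOKING of an edge / a root: the own window of its event plus the windows of its determined tail. [folklore] -/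
def booking (W : ε → ℕ) (ev : ι → ε) (tail : ι → List (ε × ℕ)) (c : ι) : ℕ :=
  W (ev c) + windows W (tail c)

omit [DecidableEq ι] in
/-- ‹ALIVE ACROSS THE HORIZON› from pendingness: a grove reaching beyond `j + Ah` has horizon `≥ Ah − last`. [folklore] -/
theorem horizon_alive {W : ε → ℕ} {j Ah : ℕ} {Φ : EventForest ι} {grove : ι → Grove ε} {c : ι}
    (hpend : j + Ah < mreach W (grove c)) : Ah - Φ.last c ≤ horizon W j Φ grove c := by
  unfold horizon; omega

omit [DecidableEq ι] in
/-- The per-edge increment in forest coordinates (`Script.increment`). [folklore] -/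
theorem horizon_increment {W : ε → ℕ} {j : ℕ} {Φ : EventForest ι} {grove : ι → Grove ε} {ev : ι → ε}
    {tail : ι → List (ε × ℕ)} {c : ι} (hc : c ∈ Φ.Cmp) (hr : c ∉ Φ.roots)
    (hstep : Script W (grove (Φ.parent c)) ((ev c, j + Φ.last c) :: tail c) (grove c)) :
    horizon W j Φ grove c + (Φ.last c - Φ.last (Φ.parent c)) ≤
      horizon W j Φ grove (Φ.parent c) + booking W ev tail c := by
  have h := (hstep.increment (Φ.last_lt c hc hr).le).1
  simpa [horizon, booking] using h

/-- **LEDGER-REALISED BANKED PRICING ⇒ PER-FIBRE EVENT DOMINATION** (root side as a profile).  As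
`…T4PersistenceRenewal.ForestDom.of_banked_pricing_le` — same forest `Φ`, weight majorant `ω ≥ 0`, root profile `b` with
budget `b s·z^s ≤ B₀·a₀` and banked root bound, shapes (SH) / catalogue `φ`, `Shapes` / (ENT) at ages `≤ Ah`, slack —
EXCEPT that the effective horizon is no longer consumer data but `horizon W j Φ grove` of a LEDGER REALISATION
(`grove c` = the slot's grove in the history `c`, `ev c` / `tail c` = the undone event and its determined consequences,
`j` = the slot's birth step): `hstep` — every non-root component arises from its parent by the script headed by `ev c`
at step `j + last c`; `hpend` — a pending history's grove reaches beyond the horizon `j + Ah`; and the banked price is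
replaced by the RAW PRICE `hraw : ω c ≤ pr c·ω (parent c)` — THE UNPRINTED CLAUSE (PR-raw), cell gap G-ne7bp2-1 —
and the OWN-BOOKING PAIRING `hpair : pr c·z₁^(booking c) ≤ φ (age) (lag) (shape c)`.
Conclusion `ForestDom Pend w a₀ Ah z η B₀ (1/(1 − z₁⁻¹z))`. [folklore] -/
theorem forestDom_of_grove_le {Sh : Type*} [DecidableEq Sh] {Pend : Finset ι} {w : ι → ℝ} {a₀ : ℝ} {Ah : ℕ}
    {z z₁ η B₀ εc : ℝ} (Φ : EventForest ι) (ω : ι → ℝ) (b : ℕ → ℝ)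
    (shape : ι → Sh) (pr : ι → ℝ) (φ : ℕ → ℕ → Sh → ℝ) (Shapes : ℕ → ℕ → Finset Sh)
    -- the ledger realisation: windows, slot birth step, groves, undone events and their determined tails
    (W : ε → ℕ) (j : ℕ) (grove : ι → Grove ε) (ev : ι → ε) (tail : ι → List (ε × ℕ))
    -- tilts and catalogue mass
    (hz : 1 ≤ z) (hzz : z < z₁) (hε : 0 ≤ εc)
    (pend_sub : Pend ⊆ Φ.Cmp) (hCmp : ∀ c ∈ Φ.Cmp, Φ.last c ≤ Ah) (ω_nonneg : ∀ c ∈ Φ.Cmp, 0 ≤ ω c)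
    (hslack : εc * ((z / z₁) / (1 - z / z₁)) ≤ 1 - η)
    -- roots (profile form, as in `of_banked_pricing_le`; raw form: `forestDom_of_grove_raw`)
    (root_budget : ∀ s, b s * z ^ s ≤ B₀ * a₀)
    (root : ∀ s, ∑ c ∈ Φ.Cmp with (Φ.last c = s ∧ c ∈ Φ.roots), ω c * z₁ ^ (horizon W j Φ grove c) ≤ b s)
    -- (SH) shapes and the catalogue
    (hinj : ∀ c₁ ∈ Φ.Cmp, ∀ c₂ ∈ Φ.Cmp, c₁ ∉ Φ.roots → c₂ ∉ Φ.roots → Φ.parent c₁ = Φ.parent c₂ →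
      Φ.last c₁ = Φ.last c₂ → shape c₁ = shape c₂ → c₁ = c₂)
    (hmem : ∀ c ∈ Φ.Cmp, c ∉ Φ.roots → shape c ∈ Shapes (Φ.last c) (Φ.last c - Φ.last (Φ.parent c)))
    (hφ : ∀ s, s ≤ Ah → ∀ ℓ, ∀ σ ∈ Shapes s ℓ, 0 ≤ φ s ℓ σ)
    -- LEDGER: every edge is one scripted ledger move headed by the undone event
    (hstep : ∀ c ∈ Φ.Cmp, c ∉ Φ.roots → Script W (grove (Φ.parent c)) ((ev c, j + Φ.last c) :: tail c) (grove c))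
    -- (PR-raw) THE UNPRINTED CLAUSE: the raw conditional price of one more event, context-uniform
    (hraw : ∀ c ∈ Φ.Cmp, c ∉ Φ.roots → ω c ≤ pr c * ω (Φ.parent c))
    -- (PAIR) the edge's price paired against ITS OWN booking at the pairing tilt, into the catalogue price
    (hpair : ∀ c ∈ Φ.Cmp, c ∉ Φ.roots →
      pr c * z₁ ^ (booking W ev tail c) ≤ φ (Φ.last c) (Φ.last c - Φ.last (Φ.parent c)) (shape c))
    -- (ENT) catalogue sums at ages within the horizon
    (hent : ∀ s, s ≤ Ah → ∀ ℓ, ∑ σ ∈ Shapes s ℓ, φ s ℓ σ ≤ εc)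
    -- PENDING: the grove reaches beyond the horizon; actual weights under the majorant
    (hpend : ∀ c ∈ Pend, j + Ah < mreach W (grove c)) (weight_le : ∀ c ∈ Pend, w c ≤ ω c) :
    ForestDom Pend w a₀ Ah z η B₀ (1 / (1 - z₁⁻¹ * z)) :=
  ForestDom.of_banked_pricing_le Φ ω (horizon W j Φ grove) b shape φ Shapes hz hzz hε pend_sub hCmp ω_nonneg hslack
    root_budget root hinj hmem hφ
    (fun c hc hr => banked_price_of_increment (hz.trans hzz.le) (ω_nonneg c hc) (ω_nonneg _ (Φ.parent_mem c hc hr))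
      (hraw c hc hr) (hpair c hc hr) (horizon_increment hc hr (hstep c hc hr)))
    hent (fun c hc => horizon_alive (hpend c hc)) weight_le

/-- **THE RAW FORM ON BOTH SIDES** — NE7b's renewal member with EVERYTHING but two raw relative prices discharged by
the ledger and the catalogue.  LEDGER: `hroot` (a root component is the bare birth of the slot's first region `ev c` at
step `j`, age `0`, followed by its determined script `tail c`), `hstep`, `hpend` as above.  CATALOGUE: (SH), (PAIR),
(ENT), the ROOT PAIRING MASS `Σ_{roots} pr c·z₁^(booking c) ≤ B₀`, the slack.  UNPRINTED (cell gap G-ne7bp2-1, final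
currency): (E2-rel-raw) `hraw₀ : ω c ≤ pr c·a₀` on roots — the insertion price of one bare large-field region relative to
the context weight `a₀` —, and (PR-raw) `hraw : ω c ≤ pr c·ω (parent c)` — the conditional price of one more event —,
context-uniform.  Conclusion `ForestDom Pend w a₀ Ah z η B₀ (1/(1 − z₁⁻¹z))`; the root profile is `b 0 = B₀·a₀`,
`b s = 0` else. [folklore] -/
theorem forestDom_of_grove_raw {Sh : Type*} [DecidableEq Sh] {Pend : Finset ι} {w : ι → ℝ} {a₀ : ℝ} {Ah : ℕ}
    {z z₁ η B₀ εc : ℝ} (Φ : EventForest ι) (ω : ι → ℝ)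
    (shape : ι → Sh) (pr : ι → ℝ) (φ : ℕ → ℕ → Sh → ℝ) (Shapes : ℕ → ℕ → Finset Sh)
    (W : ε → ℕ) (j : ℕ) (grove : ι → Grove ε) (ev : ι → ε) (tail : ι → List (ε × ℕ))
    (hz : 1 ≤ z) (hzz : z < z₁) (hε : 0 ≤ εc) (ha₀ : 0 ≤ a₀) (hB₀ : 0 ≤ B₀)
    (pend_sub : Pend ⊆ Φ.Cmp) (hCmp : ∀ c ∈ Φ.Cmp, Φ.last c ≤ Ah) (ω_nonneg : ∀ c ∈ Φ.Cmp, 0 ≤ ω c)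
    (hslack : εc * ((z / z₁) / (1 - z / z₁)) ≤ 1 - η)
    -- LEDGER, roots: bare birth at the slot step, age 0, then the determined tail
    (hroot : ∀ c ∈ Φ.Cmp, c ∈ Φ.roots →
      Φ.last c = 0 ∧ Script W ({Gen.born (ev c) j} : Grove ε) (tail c) (grove c))
    -- (E2-rel-raw) UNPRINTED: insertion price of a bare region relative to the context weight
    (hraw₀ : ∀ c ∈ Φ.Cmp, c ∈ Φ.roots → ω c ≤ pr c * a₀)
    -- root pairing mass
    (hpair₀ : ∑ c ∈ Φ.Cmp with c ∈ Φ.roots, pr c * z₁ ^ (booking W ev tail c) ≤ B₀)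
    (hinj : ∀ c₁ ∈ Φ.Cmp, ∀ c₂ ∈ Φ.Cmp, c₁ ∉ Φ.roots → c₂ ∉ Φ.roots → Φ.parent c₁ = Φ.parent c₂ →
      Φ.last c₁ = Φ.last c₂ → shape c₁ = shape c₂ → c₁ = c₂)
    (hmem : ∀ c ∈ Φ.Cmp, c ∉ Φ.roots → shape c ∈ Shapes (Φ.last c) (Φ.last c - Φ.last (Φ.parent c)))
    (hφ : ∀ s, s ≤ Ah → ∀ ℓ, ∀ σ ∈ Shapes s ℓ, 0 ≤ φ s ℓ σ)
    (hstep : ∀ c ∈ Φ.Cmp, c ∉ Φ.roots → Script W (grove (Φ.parent c)) ((ev c, j + Φ.last c) :: tail c) (grove c))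
    -- (PR-raw) UNPRINTED: conditional price of one more event relative to the truncated history
    (hraw : ∀ c ∈ Φ.Cmp, c ∉ Φ.roots → ω c ≤ pr c * ω (Φ.parent c))
    (hpair : ∀ c ∈ Φ.Cmp, c ∉ Φ.roots →
      pr c * z₁ ^ (booking W ev tail c) ≤ φ (Φ.last c) (Φ.last c - Φ.last (Φ.parent c)) (shape c))
    (hent : ∀ s, s ≤ Ah → ∀ ℓ, ∑ σ ∈ Shapes s ℓ, φ s ℓ σ ≤ εc)
    (hpend : ∀ c ∈ Pend, j + Ah < mreach W (grove c)) (weight_le : ∀ c ∈ Pend, w c ≤ ω c) :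
    ForestDom Pend w a₀ Ah z η B₀ (1 / (1 - z₁⁻¹ * z)) := by
  have hz₁ : 1 ≤ z₁ := hz.trans hzz.le
  have hz0 : 0 ≤ z := le_trans zero_le_one hz
  -- the root profile: everything at age 0
  let b : ℕ → ℝ := fun s => if s = 0 then B₀ * a₀ else 0
  refine forestDom_of_grove_le Φ ω b shape pr φ Shapes W j grove ev tail hz hzz hε pend_sub hCmp ω_nonneg hslack
    ?_ ?_ hinj hmem hφ hstep hraw hpair hent hpend weight_le
  · -- root budget
    intro s
    by_cases hs : s = 0
    · subst hs; simp [b]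
    · simp only [b, if_neg hs, zero_mul]; exact mul_nonneg hB₀ ha₀
  · -- banked root bound from the raw root price and the root pairing mass
    intro s
    by_cases hs : s = 0
    · subst hs
      simp only [b, if_pos rfl]
      have hfilter : (Φ.Cmp.filter fun c => Φ.last c = 0 ∧ c ∈ Φ.roots) = Φ.Cmp.filter fun c => c ∈ Φ.roots := by
        refine Finset.filter_congr fun c hc => ⟨fun h => h.2, fun h => ⟨(hroot c hc h).1, h⟩⟩
      rw [hfilter]
      calc ∑ c ∈ Φ.Cmp with c ∈ Φ.roots, ω c * z₁ ^ (horizon W j Φ grove c)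
          ≤ ∑ c ∈ Φ.Cmp with c ∈ Φ.roots, pr c * z₁ ^ (booking W ev tail c) * a₀ := by
            refine Finset.sum_le_sum fun c hc => ?_
            obtain ⟨hcC, hcr⟩ := Finset.mem_filter.1 hc
            obtain ⟨hl0, hscr⟩ := hroot c hcC hcr
            refine banked_root_of_raw hz₁ (ω_nonneg c hcC) (hraw₀ c hcC hcr) ?_
            have h := hscr.root_horizon_le
            simp only [horizon, booking, hl0, Nat.add_zero]
            exact h
        _ = (∑ c ∈ Φ.Cmp with c ∈ Φ.roots, pr c * z₁ ^ (booking W ev tail c)) * a₀ := by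
            rw [Finset.sum_mul]
        _ ≤ B₀ * a₀ := mul_le_mul_of_nonneg_right hpair₀ ha₀
    · simp only [b, if_neg hs]
      have hempty : (Φ.Cmp.filter fun c => Φ.last c = s ∧ c ∈ Φ.roots) = ∅ := by
        refine Finset.filter_eq_empty_iff.2 fun c hc h => hs ?_
        rw [← h.1, (hroot c hc h.2).1]
      rw [hempty, Finset.sum_empty]

end Constructor

/-! ## §4 Non-vacuity: the dictionary's sanity genealogy as a two-step script, horizons and increments decided -/

section Sanity

open Gen

/-- the root grove of the sanity slot: the first region, born at step `0`, window `3` [folklore] -/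
def g₀ : Grove ℕ := {born 0 0}
/-- after the BIRTH of constituent `1` at step `1` (window `4`) [folklore] -/
def g₁ : Grove ℕ := born 1 1 ::ₘ {born 0 0}
/-- after the MERGER (event `2`, window `2`) at step `3`: the dictionary's genealogy `G₀` [folklore] -/
def g₂ : Grove ℕ := {G₀}

/-- reaches `3, 5, 7` [folklore] -/
example : mreach W₀ g₀ = 3 ∧ mreach W₀ g₁ = 5 ∧ mreach W₀ g₂ = 7 := by
  refine ⟨?_, ?_, ?_⟩ <;> simp [g₀, g₁, g₂, G₀, W₀]

/-- the birth of constituent `1` at step `1 ≤ 3` is a ledger step [folklore] -/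
theorem step₁ : Step W₀ g₀ 1 1 g₁ :=
  Step.birth (by simp [g₀, W₀])

/-- the merger at step `3` (both partners alive: `3 ≤ 3`, `3 ≤ 5`) is a ledger step producing `G₀` (groves being
multisets, the grove `g₁` is also `born 0 0 ::ₘ born 1 1 ::ₘ 0`) [folklore] -/
theorem step₂ : Step W₀ g₁ 2 3 g₂ := by
  show Step W₀ (born 1 1 ::ₘ born 0 0 ::ₘ 0) 2 3 (G₀ ::ₘ 0)
  rw [Multiset.cons_swap]
  exact Step.merge (by simp [W₀]) (by simp [W₀])

/-- the dictionary's well-formedness of `G₀` yields the merger step too, at the later root step `1` -/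
example : Step W₀ (born 0 0 ::ₘ born 1 1 ::ₘ 0) 2 1 g₂ :=
  Step.merge_of_wf G₀_wf (0 : Grove ℕ)

/-- the whole history as ONE script from the root grove: birth then merger, own windows `4 + 2` [folklore] -/
theorem script₀ : Script W₀ g₀ [(1, 1), (2, 3)] g₂ :=
  Script.cons step₁ (Script.single step₂)

/-- EDGE 1 (birth, ages `0 → 1`, slot step `j = 0`): horizons `E₀ = 3 − 0 = 3`, `E₁ = 5 − 1 = 4`; increment
`4 + 1 ≤ 3 + 4` and lag `1 ≤ 3` — by `Step.increment` -/
example : (mreach W₀ g₁ - (0 + 1)) + (1 - 0) ≤ (mreach W₀ g₀ - (0 + 0)) + W₀ 1 ∧ 1 - 0 ≤ mreach W₀ g₀ - (0 + 0) :=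
  step₁.increment (Nat.zero_le 1)

/-- EDGE 2 (merger, ages `1 → 3`): `E₂ = 7 − 3 = 4`; increment `4 + 2 ≤ 4 + 2` — TIGHT — and lag `2 ≤ 4` -/
example : (mreach W₀ g₂ - (0 + 3)) + (3 - 1) ≤ (mreach W₀ g₁ - (0 + 1)) + W₀ 2 ∧ 3 - 1 ≤ mreach W₀ g₁ - (0 + 1) :=
  step₂.increment (by norm_num)

/-- the same history read as ONE m1 edge (the birth at step `1`; the merger its DETERMINED consequence): booking
`4 + 2`, increment `6 + 1 ≤ 3 + 6`, lag `1 ≤ 3`, by `Script.increment` -/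
example : (mreach W₀ g₂ - (0 + 1)) + (1 - 0) ≤ (mreach W₀ g₀ - (0 + 0)) + windows W₀ [(1, 0 + 1), (2, 3)] ∧
    1 - 0 ≤ mreach W₀ g₀ - (0 + 0) :=
  script₀.increment (Nat.zero_le 1)

/-- the numbers behind the three displays, decided -/
example : (5 - (0 + 1)) + (1 - 0) ≤ (3 - (0 + 0)) + 4 ∧ (7 - (0 + 3)) + (3 - 1) = (5 - (0 + 1)) + 2 ∧
    (7 - (0 + 1)) + (1 - 0) ≤ (3 - (0 + 0)) + (4 + 2) := by decide

/-- pendingness at `K = 6` (`j + Ah = 0 + 6 < 7 = mreach g₂`) gives ‹alive across the horizon› `6 − 3 ≤ E₂ = 4` -/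
example : (6 : ℕ) - 3 ≤ 7 - (0 + 3) := by decide

end Sanity

end Literature.MathematicalPhysics.QuantumFieldTheory.Balaban1983to89.T4PersistenceGrove
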